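import Literature.AnabelianGeometry.EtaleTheta.Discharge.Sec2DtpYThetaAbelian
import Literature.AnabelianGeometry.EtaleTheta.Discharge.Sec1DeltaEllExtensionOfClosure
import Literature.AnabelianGeometry.SemiGraphs.TemperedCyclotomicClosures
import Literature.AnabelianGeometry.EtaleTheta.ThetaQuotientFacts
import HarnessLib

/-!
# [EtTh] §1 pp. 12–13 «(Δ^tp_Y)^Θ is abelian» at the L3 interface `OncePuncturedTemperedGroup`:
# `[ι Δ^tp_Y, ι Δ^tp_Y] ≤ [Δ_X,[Δ_X,Δ_X]]⁻` for EVERY datum (proof-only; step 1 of the FACT-LIST reduction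
# F-0658 `DeltaThetaIsoTate` ⟸ F-1697 `DeltaYEllClosureIsoTate`)

Mochizuki, *The étale theta function and its Frobenioid-theoretic manifestations*, Publ. RIMS **45** (2009)
[EtTh], §1, PRIMS PDF pp. 12–13 (printed 238–239): "Since `Δ_X` is a profinite free group on 2 generators,
we also have a natural exact sequence `1 → ∧² Δ^ell_X (≅ Ẑ(1)) → Δ^Θ_X → Δ^ell_X → 1` … a natural exact
sequence of abelian profinite groups `1 → Δ_Θ → (Δ^tp_Y)^Θ → (Δ^tp_Y)^ell → 1`" [cite: MochizukiEtTh2009, §1 p.12].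
abc-iut cell, block C / F = FACT-PROVING WAVE, seat abc-iut-f-172 (gen 2), tranche 172 (F-0658 · F-0659 ·
F-1697); PROOF-ONLY (no `def`, no `instance`, no named fact).  A read-only consumer of abc-iut-L3's frozen
interface `SemiGraphs/TemperedCurves.lean` · `TemperedThetaQuotients.lean` · `TemperedCyclotomic.lean`
(`OncePuncturedTemperedGroup K`: `Π^tp_X = D.Pi`, `ι = D.toHat : Π^tp_X → Π_X = D.PiHat` a profinite
completion, `Δ_X = D.deltaHat`, `K₂ = D.ellKerHat = [Δ_X,Δ_X]⁻`, `K₃ = D.doubleCommutator = [Δ_X,[Δ_X,Δ_X]]⁻`,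
`Π^tp_Y = D.piY = Ker(zQuot)`, `Δ^tp_Y = D.deltaY`); nothing of it is edited or restated.

This is the L3-interface twin of abc-iut-L2-t8's `ThetaSetting.dtpYTheta_comm` (`Sec2DtpYThetaAbelian.lean`,
stated for the `p`-adic theta setting `ThetaSetting p`); the generic class-two algebra (`ClassTwo`,
`DtpYAbelian`, seats abc-iut-L5-t14 / abc-iut-L2-t8) is imported and re-instantiated at `ι := D.toHat`, the
interface-specific steps are re-proved here from the L3 fields (`isProfiniteCompletion_toHat`,
`isOpen_ker_zQuot`, `deltaHat_free`, the cusp data through abc-iut-L2-t7's `DeltaEllZHat.zQuot_delta_surjective`).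

WHAT IS PROVED, for EVERY `D : OncePuncturedTemperedGroup K` (no origin binder, any field `K`):
* `OncePuncturedCyclotomic.exists_character` — the mod-`N` character `Λ : Π_X → ℤ/N` with open kernel
  extending `Π^tp_X ↠ Z ↠ ℤ/N` (profinite completion: `comap_surjective` + density);
* `OncePuncturedCyclotomic.exists_generators` — a free pair `a, b ∈ Δ_X` (universal property with
  uniqueness against finite discrete groups) which generates `Δ_X` modulo every open normal subgroup;
* `OncePuncturedCyclotomic.exists_eq_zpow_mul_of_mem_delta` — `Δ^tp_X = σ^ℤ · Δ^tp_Y` for `σ ∈ Δ^tp_X ↦ 1 ∈ Z`;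
* `OncePuncturedCyclotomic.commutator_toHat_mem_doubleCommutator` — **`[ι y, ι y'] ∈ [Δ_X,[Δ_X,Δ_X]]⁻` for
  `y, y' ∈ Δ^tp_Y`**: separation by open normal subgroups, normal forms `a^i b^j c m`, the character kills
  `ι Δ^tp_Y` and is unimodular on `(a, b)` (`Δ^tp_X ↠ Z`), so the `2 × 2` determinant vanishes mod `N` and
  Witt–Hall gives `[ι y, ι y'] ≡ [a,b]^{ij'−ji'} ≡ 1`;
* `OncePuncturedCyclotomic.commutator_closureDeltaY_le_doubleCommutator` — closure form: with
  `N = (ι Δ^tp_Y)⁻ ≤ Δ_X`, `[N, N] ≤ K₃` ("`(Δ^tp_Y)^Θ` and its closure are abelian"), and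
  `commutator_map_deltaY_closure_le` — `[ι Δ^tp_Y, N] ≤ K₃`.

HONEST FRAMING: [EtTh] is refereed; the L3 interface is DATA quoting print, asserted for no curve; this is
OUR kernel check that the printed sentence follows from the typed fields; nothing here bears on [IUTchIII]
Cor. 3.12; typed ≠ proved; no side is taken on any disputed claim.
-/

noncomputable section

namespace Literature.AnabelianGeometry.EtaleTheta

open Literature.AnabelianGeometry.SemiGraphs
open _root_.Topology
open scoped commutatorElement
open ClassTwo DtpYAbelian

namespace OncePuncturedCyclotomic

universe u

variable {K : Type u} [Field K] (D : OncePuncturedTemperedGroup K)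

/-! ### The mod-`N` character of `Π_X` -/

/-- **The mod-`N` character of `Π_X`** ([EtTh] p. 12, "`Π^tp_X ↠ Z`" and "`Π_X := (Π^tp_X)^∧`"): for `N ≥ 1`
the surjection `Π^tp_X ↠ Z ↠ ℤ/Nℤ` extends along `ι : Π^tp_X → Π_X` to a homomorphism `Λ : Π_X → ℤ/Nℤ` with
OPEN kernel — `Ker(Π^tp_X ↠ ℤ/Nℤ)` is open, normal, of finite index, hence the pull-back of an open normal
subgroup `V ≤ Π_X` (`IsProfiniteCompletion.comap_surjective`), and `Π^tp_X/Ker → Π_X/V` is a bijection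
(density of `ι`).  L3 twin of abc-iut-L2-t8's `ThetaSetting.exists_character`. [cite: MochizukiEtTh2009, §1 p.12] -/
theorem exists_character (N : ℕ) [NeZero N] :
    ∃ Λ : D.PiHat →* Multiplicative (ZMod N), IsOpen ((Λ.ker : Subgroup D.PiHat) : Set D.PiHat) ∧
      ∀ g : D.Pi, Λ (D.toHat g) = Multiplicative.ofAdd ((Multiplicative.toAdd (D.zQuot g) : ℤ) : ZMod N) := by
  -- the character `χ = zQuot mod N` of `Π^tp_X`
  let χ : D.Pi →* Multiplicative (ZMod N) :=
    (AddMonoidHom.toMultiplicative (Int.castAddHom (ZMod N))).comp D.zQuot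
  have hχ : ∀ g : D.Pi, χ g = Multiplicative.ofAdd ((Multiplicative.toAdd (D.zQuot g) : ℤ) : ZMod N) :=
    fun g => rfl
  have hχsurj : Function.Surjective χ := by
    intro z
    obtain ⟨m, hm⟩ := ZMod.intCast_surjective (Multiplicative.toAdd z)
    obtain ⟨g, hg⟩ := D.zQuot_surjective (Multiplicative.ofAdd m)
    refine ⟨g, ?_⟩
    rw [hχ, hg, toAdd_ofAdd, hm, ofAdd_toAdd]
  have hopen : IsOpen (((χ.ker : Subgroup D.Pi)) : Set D.Pi) := by
    refine Subgroup.isOpen_mono (fun y hy => ?_) D.isOpen_ker_zQuot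
    rw [MonoidHom.mem_ker] at hy
    rw [MonoidHom.mem_ker, hχ, hy, toAdd_one, Int.cast_zero, ofAdd_zero]
  let U₀ : OpenNormalSubgroup D.Pi :=
    { toSubgroup := χ.ker, isOpen' := hopen, isNormal' := inferInstance }
  have hfi : U₀.toSubgroup.FiniteIndex := by
    refine ⟨?_⟩
    change χ.ker.index ≠ 0
    rw [Subgroup.index_ker]
    exact Nat.card_pos.ne'
  obtain ⟨V, hV⟩ := D.isProfiniteCompletion_toHat.comap_surjective U₀ hfi
  change χ.ker = V.toSubgroup.comap D.toHat.toMonoidHom at hV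
  let e : D.Pi ⧸ χ.ker →* D.PiHat ⧸ V.toSubgroup :=
    QuotientGroup.map χ.ker V.toSubgroup D.toHat.toMonoidHom (le_of_eq hV)
  have he_inj : Function.Injective e := by
    rw [← MonoidHom.ker_eq_bot_iff, eq_bot_iff]
    intro q hq
    obtain ⟨g, rfl⟩ := QuotientGroup.mk_surjective q
    rw [MonoidHom.mem_ker, QuotientGroup.map_mk, QuotientGroup.eq_one_iff] at hq
    rw [Subgroup.mem_bot, QuotientGroup.eq_one_iff, hV]
    exact hq
  have he_surj : Function.Surjective e := by
    intro q
    obtain ⟨h, rfl⟩ := QuotientGroup.mk_surjective q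
    have hopen' : IsOpen ((fun x : D.PiHat => h⁻¹ * x) ⁻¹' (V : Set D.PiHat)) :=
      V.toOpenSubgroup.isOpen.preimage (by fun_prop)
    have hne : ((fun x : D.PiHat => h⁻¹ * x) ⁻¹' (V : Set D.PiHat)).Nonempty :=
      ⟨h, by simp only [Set.mem_preimage, inv_mul_cancel, SetLike.mem_coe, one_mem]⟩
    obtain ⟨g, hg⟩ := D.isProfiniteCompletion_toHat.denseRange.exists_mem_open hopen' hne
    refine ⟨QuotientGroup.mk g, ?_⟩
    change QuotientGroup.mk (D.toHat.toMonoidHom g) = QuotientGroup.mk h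
    rw [QuotientGroup.eq]
    have hg' : h⁻¹ * D.toHat g ∈ V := hg
    have := V.toSubgroup.inv_mem hg'
    rw [mul_inv_rev, inv_inv] at this
    exact this
  let eE : D.Pi ⧸ χ.ker ≃* D.PiHat ⧸ V.toSubgroup := MulEquiv.ofBijective e ⟨he_inj, he_surj⟩
  let Λ : D.PiHat →* Multiplicative (ZMod N) :=
    ((QuotientGroup.kerLift χ).comp eE.symm.toMonoidHom).comp (QuotientGroup.mk' V.toSubgroup)
  refine ⟨Λ, ?_, fun g => ?_⟩
  · refine Subgroup.isOpen_mono (fun v hv => ?_) V.toOpenSubgroup.isOpen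
    rw [MonoidHom.mem_ker]
    change QuotientGroup.kerLift χ (eE.symm (QuotientGroup.mk' V.toSubgroup v)) = 1
    rw [QuotientGroup.mk'_apply, (QuotientGroup.eq_one_iff v).mpr hv, map_one, map_one]
  · change QuotientGroup.kerLift χ (eE.symm (QuotientGroup.mk' V.toSubgroup (D.toHat g))) = _
    have heg : eE (QuotientGroup.mk g) = QuotientGroup.mk' V.toSubgroup (D.toHat g) := by
      change e (QuotientGroup.mk g) = _
      rw [QuotientGroup.map_mk, QuotientGroup.mk'_apply]
      rfl
    rw [← heg, MulEquiv.symm_apply_apply, QuotientGroup.kerLift_mk, hχ]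

/-! ### The free pair of `Δ_X` -/

/-- **The free pair generates `Δ_X` modulo every open normal subgroup** ("`Δ_X` is a profinite free group on
2 generators", [EtTh] p. 12; interface field `deltaHat_free`): there are `a, b ∈ Δ_X` with the free universal
property (every pair of elements of a finite discrete group is the image of `(a, b)` under a unique continuous
homomorphism), and — by the UNIQUENESS clause against the finite discrete quotient `Δ_X/(M ∩ Δ_X)` — every
`x ∈ Δ_X` is `s · m` with `s` in the subgroup generated by `a, b` and `m ∈ M`, for each open normal `M ≤ Π_X`.
L3 twin of abc-iut-L2-t8's `IsEtThOrigin.exists_generators`. [cite: MochizukiEtTh2009, §1 p.12] -/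
theorem exists_generators :
    ∃ a b : ↥D.deltaHat,
      (∀ (Q : Type u) [Group Q] [Finite Q] [TopologicalSpace Q] [DiscreteTopology Q] (x y : Q),
        ∃! f : ↥D.deltaHat →ₜ* Q, f a = x ∧ f b = y) ∧
      ∀ M : Subgroup D.PiHat, M.Normal → IsOpen (M : Set D.PiHat) →
        ∀ x ∈ D.deltaHat, ∃ s ∈ Subgroup.closure ({(a : D.PiHat), (b : D.PiHat)} : Set D.PiHat),
          ∃ m ∈ M, x = s * m := by
  classical
  haveI : CompactSpace D.PiHat := D.isProfiniteCompletion_toHat.compactSpace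
  haveI : CompactSpace ↥D.deltaHat := isCompact_iff_compactSpace.mp D.isClosed_deltaHat.isCompact
  obtain ⟨g, hg⟩ := D.deltaHat_isFree
  -- the pair form of the universal property
  have huniv : ∀ (Q : Type u) [Group Q] [Finite Q] [TopologicalSpace Q] [DiscreteTopology Q] (x y : Q),
      ∃! f : ↥D.deltaHat →ₜ* Q, f (g 0) = x ∧ f (g 1) = y := by
    intro Q _ _ _ _ x y
    obtain ⟨f, hf, huniq⟩ := hg Q ![x, y]
    refine ⟨f, ⟨by simpa using hf 0, by simpa using hf 1⟩, fun f' hf' => huniq f' fun i => ?_⟩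
    fin_cases i
    · simpa using hf'.1
    · simpa using hf'.2
  refine ⟨g 0, g 1, huniv, fun M hMn hMo x hx => ?_⟩
  set a : ↥D.deltaHat := g 0 with hadef
  set b : ↥D.deltaHat := g 1 with hbdef
  haveI : M.Normal := hMn
  let MΔ : Subgroup ↥D.deltaHat := M.subgroupOf D.deltaHat
  have hMΔo : IsOpen (MΔ : Set ↥D.deltaHat) := hMo.preimage continuous_subtype_val
  haveI : DiscreteTopology (↥D.deltaHat ⧸ MΔ) := QuotientGroup.discreteTopology hMΔo
  haveI : Finite (↥D.deltaHat ⧸ MΔ) := Subgroup.quotient_finite_of_isOpen MΔ hMΔo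
  let π : ↥D.deltaHat →ₜ* ↥D.deltaHat ⧸ MΔ :=
    { toMonoidHom := QuotientGroup.mk' MΔ, continuous_toFun := QuotientGroup.continuous_mk }
  let H : Subgroup (↥D.deltaHat ⧸ MΔ) := Subgroup.closure ({π a, π b} : Set (↥D.deltaHat ⧸ MΔ))
  have haH : π a ∈ H := Subgroup.subset_closure (Set.mem_insert _ _)
  have hbH : π b ∈ H := Subgroup.subset_closure (Set.mem_insert_of_mem _ (Set.mem_singleton _))
  obtain ⟨f, ⟨hfa, hfb⟩, -⟩ := huniv H ⟨π a, haH⟩ ⟨π b, hbH⟩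
  obtain ⟨g₀, -, hg₀⟩ := huniv (↥D.deltaHat ⧸ MΔ) (π a) (π b)
  let g₁ : ↥D.deltaHat →ₜ* ↥D.deltaHat ⧸ MΔ :=
    { toMonoidHom := H.subtype.comp f.toMonoidHom
      continuous_toFun := continuous_subtype_val.comp f.continuous_toFun }
  have h1 : g₁ = g₀ := by
    refine hg₀ g₁ ⟨?_, ?_⟩
    · change (f a : ↥D.deltaHat ⧸ MΔ) = π a
      rw [hfa]
    · change (f b : ↥D.deltaHat ⧸ MΔ) = π b
      rw [hfb]
  have h2 : π = g₀ := hg₀ π ⟨rfl, rfl⟩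
  have hπH : ∀ y : ↥D.deltaHat, π y ∈ H := by
    intro y
    have hy : π y = g₁ y := by rw [h1, ← h2]
    rw [hy]
    exact (f y).2
  have hHeq : H = (Subgroup.closure ({a, b} : Set ↥D.deltaHat)).map (QuotientGroup.mk' MΔ) := by
    rw [MonoidHom.map_closure, Set.image_pair]
    rfl
  have hxH := hπH ⟨x, hx⟩
  rw [hHeq] at hxH
  obtain ⟨s, hs, hsx⟩ := hxH
  have hm : s⁻¹ * ⟨x, hx⟩ ∈ MΔ := by
    rw [← QuotientGroup.eq]
    exact hsx
  refine ⟨(s : D.PiHat), ?_, ((s⁻¹ * ⟨x, hx⟩ : ↥D.deltaHat) : D.PiHat), Subgroup.mem_subgroupOf.mp hm, ?_⟩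
  · have hs' := Subgroup.mem_map_of_mem D.deltaHat.subtype hs
    rw [MonoidHom.map_closure, Set.image_pair] at hs'
    exact hs'
  · simp only [Subgroup.coe_mul, Subgroup.coe_inv, mul_inv_cancel_left]

/-! ### `Δ^tp_X = σ^ℤ · Δ^tp_Y` -/

/-- Every `t ∈ Δ^tp_X` is `σ^i · u` with `u ∈ Δ^tp_Y = Δ^tp_X ∩ Π^tp_Y`, for `σ ∈ Δ^tp_X` with `zQuot σ = 1`
("`Δ^tp_X/Δ^tp_Y ≅ Z`", [EtTh] pp. 12, 16). [cite: MochizukiEtTh2009, §1 p.12] -/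
theorem exists_eq_zpow_mul_of_mem_delta {σ : D.Pi} (hσ : σ ∈ D.delta)
    (hσZ : D.zQuot σ = Multiplicative.ofAdd 1) {t : D.Pi} (ht : t ∈ D.delta) :
    ∃ i : ℤ, ∃ u ∈ D.deltaY, t = σ ^ i * u := by
  refine ⟨Multiplicative.toAdd (D.zQuot t), (σ ^ Multiplicative.toAdd (D.zQuot t))⁻¹ * t, ?_,
    (mul_inv_cancel_left _ _).symm⟩
  refine Subgroup.mem_inf.mpr ⟨D.delta.mul_mem (D.delta.inv_mem (D.delta.zpow_mem hσ _)) ht, ?_⟩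
  change (σ ^ Multiplicative.toAdd (D.zQuot t))⁻¹ * t ∈ D.zQuot.ker
  rw [MonoidHom.mem_ker, map_mul, map_inv, map_zpow, hσZ, ← ofAdd_zsmul, smul_eq_mul, mul_one,
    ofAdd_toAdd, inv_mul_cancel]

/-- A generator of `Z` lifts to `Δ^tp_X`: there is `σ ∈ Δ^tp_X` with `zQuot σ = 1` (`Δ^tp_X ↠ Z`,
abc-iut-L2-t7's `DeltaEllZHat.zQuot_delta_surjective` from the cusp data). [cite: MochizukiEtTh2009, §1 p.12] -/
theorem exists_delta_zQuot_eq_one : ∃ σ ∈ D.delta, D.zQuot σ = Multiplicative.ofAdd 1 :=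
  DeltaEllZHat.zQuot_delta_surjective D _

/-! ### `[ι y, ι y'] ∈ [Δ_X,[Δ_X,Δ_X]]⁻` for `y, y' ∈ Δ^tp_Y` -/

/-- `ι` carries `Δ^tp_X` into `Δ_X`. [cite: MochizukiEtTh2009, §1 p.12] -/
theorem toHat_mem_deltaHat {t : D.Pi} (ht : t ∈ D.delta) : D.toHat.toMonoidHom t ∈ D.deltaHat :=
  Subgroup.le_topologicalClosure _ ⟨t, ht, rfl⟩

/-- **`[ι y, ι y'] ∈ [Δ_X,[Δ_X,Δ_X]]⁻` for `y, y' ∈ Δ^tp_Y`** — the heart of "(Δ^tp_Y)^Θ is abelian" ([EtTh]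
pp. 12–13), at the L3 interface and from its fields alone (profinite completion, `Π^tp_X ↠ Z` with open
kernel, `Δ^tp_X ↠ Z`, freeness of `Δ_X` on two generators); see the module docstring for the proof.  L3 twin
of abc-iut-L2-t8's `ThetaSetting.commutator_toHat_mem_tripleCommutatorClosure`. [cite: MochizukiEtTh2009, §1 p.12] -/
theorem commutator_toHat_mem_doubleCommutator {y y' : D.Pi} (hy : y ∈ D.deltaY) (hy' : y' ∈ D.deltaY) :
    ⁅D.toHat.toMonoidHom y, D.toHat.toMonoidHom y'⁆ ∈ D.doubleCommutator := by
  classical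
  haveI : CompactSpace D.PiHat := D.isProfiniteCompletion_toHat.compactSpace
  haveI : TotallyDisconnectedSpace D.PiHat := D.isProfiniteCompletion_toHat.totallyDisconnectedSpace
  have hK₃closed : IsClosed ((D.doubleCommutator : Subgroup D.PiHat) : Set D.PiHat) :=
    Subgroup.isClosed_topologicalClosure _
  -- class-two data `A = Δ_X ⊇ K₂ = [Δ_X,Δ_X]⁻`, `K₃ = [Δ_X,[Δ_X,Δ_X]]⁻`
  have hAA : ⁅D.deltaHat, D.deltaHat⁆ ≤ D.ellKerHat := Subgroup.le_topologicalClosure _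
  have hK₂A : D.ellKerHat ≤ D.deltaHat := D.ellKerHat_le_deltaHat
  have hAK : ⁅D.deltaHat, D.ellKerHat⁆ ≤ D.doubleCommutator :=
    ThetaQuotientFacts.commutator_deltaHat_ellKerHat_le D
  -- the three elements of `Δ_X`: `ι y`, `ι y'`, `ι z₁` with `zQuot z₁ = 1`
  have hyΔ : D.toHat.toMonoidHom y ∈ D.deltaHat := toHat_mem_deltaHat D (Subgroup.mem_inf.mp hy).1
  have hy'Δ : D.toHat.toMonoidHom y' ∈ D.deltaHat := toHat_mem_deltaHat D (Subgroup.mem_inf.mp hy').1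
  obtain ⟨z₁, hz₁Δ, hz₁Z⟩ := exists_delta_zQuot_eq_one D
  have hz₁Δ' : D.toHat.toMonoidHom z₁ ∈ D.deltaHat := toHat_mem_deltaHat D hz₁Δ
  obtain ⟨a, b, -, hgen⟩ := exists_generators D
  -- (1) separation
  refine mem_of_forall_mem_sup _ hK₃closed fun U => ?_
  let M' : Subgroup D.PiHat := D.doubleCommutator ⊔ U.toSubgroup
  haveI hM'n : M'.Normal := inferInstance
  have hM'o : IsOpen (M' : Set D.PiHat) :=
    Subgroup.isOpen_mono (le_sup_right : U.toSubgroup ≤ M') U.toOpenSubgroup.isOpen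
  haveI : Finite (D.PiHat ⧸ M') := Subgroup.quotient_finite_of_isOpen M' hM'o
  -- (2) the character mod `N = #(Π_X/M')`
  haveI : NeZero (Nat.card (D.PiHat ⧸ M')) := ⟨Nat.card_pos.ne'⟩
  obtain ⟨Λ, hΛo, hΛ⟩ := exists_character D (Nat.card (D.PiHat ⧸ M'))
  let M : Subgroup D.PiHat := M' ⊓ Λ.ker
  haveI hMn : M.Normal := inferInstance
  have hMo : IsOpen (M : Set D.PiHat) := hM'o.inter hΛo
  have hMM' : M ≤ M' := inf_le_left
  have hMΛ : M ≤ Λ.ker := inf_le_right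
  -- class-two data modulo `M'`
  have hAK' : ⁅D.deltaHat, D.ellKerHat⁆ ≤ M' := hAK.trans le_sup_left
  -- (3) normal forms
  obtain ⟨s, hs, m, hm, hys⟩ := hgen M hMn hMo _ hyΔ
  obtain ⟨i, j, c, hc, rfl⟩ := exists_normalForm_of_mem_closure_pair D.deltaHat a.2 b.2 hs
  obtain ⟨s', hs', m', hm', hys'⟩ := hgen M hMn hMo _ hy'Δ
  obtain ⟨i', j', c', hc', rfl⟩ := exists_normalForm_of_mem_closure_pair D.deltaHat a.2 b.2 hs'
  obtain ⟨s₁, hs₁, m₁, hm₁, hzs₁⟩ := hgen M hMn hMo _ hz₁Δ'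
  obtain ⟨i₁, j₁, c₁, hc₁, rfl⟩ := exists_normalForm_of_mem_closure_pair D.deltaHat a.2 b.2 hs₁
  -- (4) the character: `Λ` kills `[Δ_X, Δ_X]` and `M`
  have hΛcomm : ∀ d ∈ ⁅D.deltaHat, D.deltaHat⁆, Λ d = 1 := fun d hd =>
    (Abelianization.commutator_subset_ker Λ) (Subgroup.commutator_mono le_top le_top hd)
  have hΛval : ∀ (i j : ℤ) {c m : D.PiHat}, c ∈ ⁅D.deltaHat, D.deltaHat⁆ → m ∈ M →
      Multiplicative.toAdd (Λ ((a : D.PiHat) ^ i * (b : D.PiHat) ^ j * c * m)) =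
        (i : ZMod _) * Multiplicative.toAdd (Λ a) + (j : ZMod _) * Multiplicative.toAdd (Λ b) := by
    intro i j c m hc hm
    have hΛm : Λ m = 1 := (MonoidHom.mem_ker).mp (hMΛ hm)
    have hmul : Λ ((a : D.PiHat) ^ i * (b : D.PiHat) ^ j * c * m) = Λ a ^ i * Λ b ^ j := by
      rw [map_mul, map_mul, map_mul, map_zpow, map_zpow, hΛcomm c hc, mul_one, hΛm, mul_one]
    rw [hmul, toAdd_mul, toAdd_zpow, toAdd_zpow, zsmul_eq_mul, zsmul_eq_mul]
  have hΛy : ∀ {y : D.Pi}, y ∈ D.deltaY → Λ (D.toHat.toMonoidHom y) = 1 := by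
    intro y hy
    have hyZ : D.zQuot y = 1 := (Subgroup.mem_inf.mp hy).2
    change Λ (D.toHat y) = 1
    rw [hΛ, hyZ, toAdd_one, Int.cast_zero, ofAdd_zero]
  have h1 : (i : ZMod (Nat.card (D.PiHat ⧸ M'))) * Multiplicative.toAdd (Λ a) +
      (j : ZMod _) * Multiplicative.toAdd (Λ b) = 0 := by
    rw [← hΛval i j hc hm, ← hys, hΛy hy, toAdd_one]
  have h2 : (i' : ZMod (Nat.card (D.PiHat ⧸ M'))) * Multiplicative.toAdd (Λ a) +
      (j' : ZMod _) * Multiplicative.toAdd (Λ b) = 0 := by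
    rw [← hΛval i' j' hc' hm', ← hys', hΛy hy', toAdd_one]
  have h3 : (i₁ : ZMod (Nat.card (D.PiHat ⧸ M'))) * Multiplicative.toAdd (Λ a) +
      (j₁ : ZMod _) * Multiplicative.toAdd (Λ b) = 1 := by
    rw [← hΛval i₁ j₁ hc₁ hm₁, ← hzs₁]
    change Multiplicative.toAdd (Λ (D.toHat z₁)) = 1
    rw [hΛ, hz₁Z, toAdd_ofAdd, toAdd_ofAdd, Int.cast_one]
  have hdet : ((i * j' - j * i' : ℤ) : ZMod (Nat.card (D.PiHat ⧸ M'))) = 0 := by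
    push_cast
    exact det_eq_zero_of_unimodular h1 h2 h3
  obtain ⟨k, hk⟩ := (ZMod.intCast_zmod_eq_zero_iff_dvd _ _).mp hdet
  -- (5) Witt–Hall modulo `M'`
  have hγN : (((⁅(a : D.PiHat), (b : D.PiHat)⁆ : D.PiHat) : D.PiHat ⧸ M')) ^
      (Nat.card (D.PiHat ⧸ M') : ℤ) = 1 := by
    rw [zpow_natCast]
    exact pow_card_eq_one'
  have hmod : ∀ {x m : D.PiHat}, m ∈ M → QuotientGroup.mk' M' (x * m) = QuotientGroup.mk' M' x := by
    intro x m hm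
    rw [map_mul, QuotientGroup.mk'_apply M' m, (QuotientGroup.eq_one_iff m).mpr (hMM' hm), mul_one]
  have key : QuotientGroup.mk' M' ⁅D.toHat.toMonoidHom y, D.toHat.toMonoidHom y'⁆ = 1 := by
    rw [hys, hys', map_commutatorElement, hmod hm, hmod hm', ← map_commutatorElement,
      QuotientGroup.mk'_apply M',
      mk_commutator_normalForm D.deltaHat _ M' hAA hK₂A hAK' a.2 b.2 (hAA hc) (hAA hc') i j i' j',
      hk, zpow_mul, hγN, one_zpow]
  exact (QuotientGroup.eq_one_iff _).mp key

/-- `[ι Δ^tp_Y, ι Δ^tp_Y] ≤ [Δ_X,[Δ_X,Δ_X]]⁻` — "`(Δ^tp_Y)^Θ` is abelian" ([EtTh] pp. 12–13) as an inclusion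
of subgroups of `Π_X`, for EVERY `D`. [cite: MochizukiEtTh2009, §1 p.12] -/
theorem commutator_map_deltaY_le :
    ⁅D.deltaY.map D.toHat.toMonoidHom, D.deltaY.map D.toHat.toMonoidHom⁆ ≤ D.doubleCommutator := by
  refine Subgroup.commutator_le.mpr ?_
  rintro _ ⟨y, hy, rfl⟩ _ ⟨y', hy', rfl⟩
  exact commutator_toHat_mem_doubleCommutator D hy hy'

/-- `[ι Δ^tp_Y, N] ≤ [Δ_X,[Δ_X,Δ_X]]⁻` for `N = (ι Δ^tp_Y)⁻` the closure of the image of `Δ^tp_Y` in `Π_X`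
(continuity of the commutator). [cite: MochizukiEtTh2009, §1 p.12] -/
theorem commutator_map_deltaY_closure_le :
    ⁅D.deltaY.map D.toHat.toMonoidHom, (D.deltaY.map D.toHat.toMonoidHom).topologicalClosure⁆ ≤
      D.doubleCommutator :=
  (commutator_topologicalClosure_right_le _ _).trans
    (Subgroup.topologicalClosure_minimal _ (commutator_map_deltaY_le D)
      (Subgroup.isClosed_topologicalClosure _))

/-- **The closure `N = (ι Δ^tp_Y)⁻` of the image of `Δ^tp_Y` in `Π_X` is abelian modulo
`K₃ = [Δ_X,[Δ_X,Δ_X]]⁻`: `[N, N] ≤ K₃`** ([EtTh] pp. 12–13, "abelian profinite groups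
`1 → Δ_Θ → (Δ^tp_Y)^Θ → (Δ^tp_Y)^ell → 1`"), for EVERY `D : OncePuncturedTemperedGroup K`.
[cite: MochizukiEtTh2009, §1 p.12] -/
theorem commutator_closureDeltaY_le_doubleCommutator :
    ⁅(D.deltaY.map D.toHat.toMonoidHom).topologicalClosure,
      (D.deltaY.map D.toHat.toMonoidHom).topologicalClosure⁆ ≤ D.doubleCommutator := by
  have h1 : ⁅(D.deltaY.map D.toHat.toMonoidHom).topologicalClosure, D.deltaY.map D.toHat.toMonoidHom⁆ ≤
      D.doubleCommutator :=
    (commutator_topologicalClosure_left_le _ _).trans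
      (Subgroup.topologicalClosure_minimal _ (commutator_map_deltaY_le D)
        (Subgroup.isClosed_topologicalClosure _))
  exact (commutator_topologicalClosure_right_le _ _).trans
    (Subgroup.topologicalClosure_minimal _ h1 (Subgroup.isClosed_topologicalClosure _))

/-- `N = (ι Δ^tp_Y)⁻ ≤ Δ_X`. [cite: MochizukiEtTh2009, §1 p.12] -/
theorem closureDeltaY_le_deltaHat : (D.deltaY.map D.toHat.toMonoidHom).topologicalClosure ≤ D.deltaHat :=
  Subgroup.topologicalClosure_minimal _
    ((Subgroup.map_mono (inf_le_left : D.deltaY ≤ D.delta)).trans (Subgroup.le_topologicalClosure _))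
    D.isClosed_deltaHat

end OncePuncturedCyclotomic

end Literature.AnabelianGeometry.EtaleTheta

end
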